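import Summits.QuantumFields.YangMills.Theorems.DiagonalMirrorRPROddTorusSwapPairingDefs
import Summits.QuantumFields.YangMills.Theorems.PencilRigidityWeakCouplingHypercubicLimitRPSwapPairingPSD
import Summits.QuantumFields.YangMills.Theorems.MirrorModularBoostsHypercubicLimitPlaneLimitsOfBound
import Summits.QuantumFields.YangMills.Theorems.MirrorModularBoostsHypercubicLimitClosureHalvesDefs
import Summits.QuantumFields.YangMills.Theorems.DiagonalMirrorRPRFamObsGrowth

/-!
# Crux `WeakCouplingHypercubicLimitRP` (stmt-QuantumFields-27398), registered lattice stub **D1′**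
`stub_oddTorusSwapPairingLiminf` (`Cruxes/WeakCouplingHypercubicLimitRP/Lines/Sketch.lean` v2, sha16 `97b02a6fc0a363ac`, l.1650) —
NEGATIVE-side structure (standing disprover `cdisprove-27398-1`, generation 2; crux workfile `Cruxes/…/Disproof.lean` §6–§7)

No disproof of D1′ was found in the admissible regime. This file lands, in definition-free form, the two structural facts that
frame every further attack on (and every supplier of) D1′:

* **Decoration** (`stub_oddTorusSwapPairingLiminf_iff_schemeLevel`): in D1′
  `∀ G r sch φ hφ T, HasWeakCouplingLimit → PolyVolume → PolyRenorm → UniformFunctionalBoundPlanes → (∃ Δ C, 0 < Δ ∧ RPSpectral) →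
  PlaneLimits r sch φ T → OddTorusSwapPairingLiminf r (subseq sch φ hφ)`
  the subsequence `φ`, the limit family `T` and `PlaneLimits` are INERT: D1′ is equivalent to the scheme-level statement
  `∀ G r sch, (same five hypotheses) → OddTorusSwapPairingLiminf r sch`. (⇐: the five hypotheses restrict to sub-schemes,
  `rpSpectral_subseq` etc.; ⇒: subsequence principle `liminf_nonneg_of_subseq` + the landed Z2 `stub_planeLimits` giving plane
  limits along a sub-subsequence + `latticeSchwinger_subseq = rfl`.) Pointwise form: `oddTorusSwapPairingLiminf_of_subsubseq`.
* **Junk gauge group** (`oddTorusSwapPairingLiminf_of_subsingleton`): for every one-element `G`, every `LatticeRep`, every scheme,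
  the own-torus swap pairing at step `k` is the perfect square `(Σᵢ cᵢ ⟨∏ⱼ Φ(fᵢⱼ)⟩_k)²` (swap covariance `latticeSchwinger_swap`,
  p827142, + factorisation), so `OddTorusSwapPairingLiminf r sch` holds with no hypothesis: the binder `G` of D1′ (no
  `IsCompactSimpleLieGroup G`) cannot be exploited.

HONEST REGISTER: nothing here bears on the Yang–Mills mass gap; these are bookkeeping facts about a stub's statement.
References: Osterwalder–Seiler, Ann. Phys. 110 (1978) §2 (lattice RP); crux workfile `Disproof.lean` (census v2).
-/

set_option autoImplicit false

noncomputable section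

open scoped SchwartzMap
open MeasureTheory Filter Topology
open Literature.MathematicalPhysics.AQFT Literature.MathematicalPhysics.QuantumLattice
open Literature.MathematicalPhysics.QuantumFieldTheory
open Literature.Probability.LatticeModels (box Site)
open Summit.QuantumFields.YangMills.Cruxes.HypercubicLimit.CouplingResponse
open Summit.QuantumFields.YangMills.Cruxes.DiagonalMirrorRPR.ParityBridgeColdTraces (E4)
open Summit.QuantumFields.YangMills.Cruxes.DiagonalMirrorRPR.ParityBridgeColdTraces.RpClosure (swap01 latticeSchwinger_swap
  latticeSchwinger_comp_equiv)
open Summit.QuantumFields.YangMills.Cruxes.DiagonalMirrorRPR.SignTwistedDiagonalTrace (OddTorusSwapPairingLiminf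
  uniformFunctionalBoundPlanes_subseq)

namespace Summit.QuantumFields.YangMills.Theorems.WeakCouplingHypercubicLimitRP.Negative.OddTorusSwapPairingLiminf

/-! ## §1 Real-sequence lemmas (junk-`liminf` aware) -/

/-- A real sequence that is eventually non-negative has non-negative `liminf` (including the junk value `0` of an unbounded
`liminf`). -/
theorem liminf_nonneg_of_eventually {u : ℕ → ℝ} (h : ∀ᶠ k in atTop, 0 ≤ u k) : 0 ≤ Filter.liminf u atTop := by
  rw [Filter.liminf_eq]
  by_cases hS : BddAbove {a : ℝ | ∀ᶠ n in atTop, a ≤ u n}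
  · exact le_csSup hS h
  · rw [Real.sSup_of_not_bddAbove hS]

/-- **Subsequence principle for `0 ≤ liminf`.** If every subsequence of a real sequence has a further subsequence with non-negative
`liminf`, the sequence has non-negative `liminf` (`liminf u < 0` yields a subsequence everywhere below `liminf u / 2`, all of whose
subsequences have `liminf ≤ liminf u / 2 < 0`; the junk value of an unbounded-below `liminf` is `0`). -/
theorem liminf_nonneg_of_subseq {u : ℕ → ℝ}
    (h : ∀ ψ : ℕ → ℕ, StrictMono ψ → ∃ φ : ℕ → ℕ, StrictMono φ ∧ 0 ≤ Filter.liminf (u ∘ ψ ∘ φ) atTop) :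
    0 ≤ Filter.liminf u atTop := by
  by_contra hneg
  push Not at hneg
  have hlim : Filter.liminf u atTop = sSup {a : ℝ | ∀ᶠ n in atTop, a ≤ u n} := Filter.liminf_eq
  have hbdd : BddAbove {a : ℝ | ∀ᶠ n in atTop, a ≤ u n} := by
    by_contra hS
    rw [hlim, Real.sSup_of_not_bddAbove hS] at hneg
    exact lt_irrefl _ hneg
  have hne : {a : ℝ | ∀ᶠ n in atTop, a ≤ u n}.Nonempty := by
    by_contra hS
    rw [Set.not_nonempty_iff_eq_empty] at hS
    rw [hlim, hS, Real.sSup_empty] at hneg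
    exact lt_irrefl _ hneg
  obtain ⟨b, hb⟩ := hne
  have hfreq : ∃ᶠ n in atTop, u n < Filter.liminf u atTop / 2 := by
    by_contra hnot
    have hmem : Filter.liminf u atTop / 2 ∈ {a : ℝ | ∀ᶠ n in atTop, a ≤ u n} :=
      (Filter.not_frequently.1 hnot).mono fun n hn => not_lt.1 hn
    have := le_csSup hbdd hmem
    rw [← hlim] at this
    linarith
  obtain ⟨ψ, hψ, hψc⟩ := Filter.extraction_of_frequently_atTop hfreq
  obtain ⟨φ, hφ, hpos⟩ := h ψ hψ
  have hbdd' : Filter.IsBoundedUnder (· ≥ ·) atTop (u ∘ ψ ∘ φ) :=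
    ⟨b, Filter.eventually_map.2 ((hψ.tendsto_atTop.comp hφ.tendsto_atTop).eventually hb)⟩
  have hle : Filter.liminf (u ∘ ψ ∘ φ) atTop ≤ Filter.liminf u atTop / 2 :=
    Filter.liminf_le_of_frequently_le (Filter.Eventually.of_forall fun n => (hψc (φ n)).le).frequently hbdd'
  linarith

/-! ## §2 Decoration: `φ`, `T`, `PlaneLimits` are inert in D1′ -/

section Decoration

variable {G : Type} [Group G] [TopologicalSpace G] [IsTopologicalGroup G] [CompactSpace G]
  [MeasurableSpace G] [BorelSpace G]

/-- `RPSpectral` (an `∀ᶠ k` clause on the scheme) restricts to sub-schemes with the same constants. -/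
theorem rpSpectral_subseq (r : LatticeRep G) (sch : SpeciesScheme (YMSpecies G)) (φ : ℕ → ℕ) (hφ : StrictMono φ)
    {Δ C : ℝ} (h : RPSpectral r sch Δ C) : RPSpectral r (subseq sch φ hφ) Δ C := by
  unfold RPSpectral at h ⊢
  exact hφ.tendsto_atTop.eventually h

/-- **Pointwise decoration removal.** If along every subsequence `ψ` some further sub-scheme `subseq (subseq sch ψ hψ) φ hφ` is
asymptotically swap-RP on its own odd tori, then so is `sch` itself (subsequence principle; `latticeSchwinger_subseq` is `rfl`). -/
theorem oddTorusSwapPairingLiminf_of_subsubseq (r : LatticeRep G) (sch : SpeciesScheme (YMSpecies G))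
    (h : ∀ ψ : ℕ → ℕ, ∀ hψ : StrictMono ψ, ∃ φ : ℕ → ℕ, ∃ hφ : StrictMono φ,
      OddTorusSwapPairingLiminf r (subseq (subseq sch ψ hψ) φ hφ)) :
    OddTorusSwapPairingLiminf r sch := by
  intro m n c f σf hf hdisj hσ
  apply liminf_nonneg_of_subseq
  intro ψ hψ
  obtain ⟨φ, hφ, hsock⟩ := h ψ hψ
  exact ⟨φ, hφ, hsock m n c f σf hf hdisj hσ⟩

/-- **D1′ (VERBATIM type of `stub_oddTorusSwapPairingLiminf`) ⟺ its scheme-level form.** `⇒`: for an admissible `sch` and any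
`ψ`, the sub-scheme `subseq sch ψ hψ` is admissible (`hasWeakCouplingLimit_subseq`, `polyVolume_subseq`, `polyRenorm_subseq`,
`uniformFunctionalBoundPlanes_subseq`, `rpSpectral_subseq`) and the LANDED Z2 `stub_planeLimits` supplies `φ, T` with
`PlaneLimits r (subseq sch ψ hψ) φ T`; D1′ there + `oddTorusSwapPairingLiminf_of_subsubseq`. `⇐`: apply the scheme-level statement to
`subseq sch φ hφ`; `T` and `PlaneLimits` are not used. -/
theorem stub_oddTorusSwapPairingLiminf_iff_schemeLevel :
    (∀ (G : Type) [Group G] [TopologicalSpace G] [IsTopologicalGroup G] [CompactSpace G]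
      [MeasurableSpace G] [BorelSpace G] (r : LatticeRep G) (sch : SpeciesScheme (YMSpecies G))
      (φ : ℕ → ℕ) (hφ : StrictMono φ)
      (T : (n : ℕ) → (Fin n → Plane) → (𝓢((Fin n → EuclideanSpace ℝ (Fin 4)), ℂ) →L[ℂ] ℂ)),
      sch.HasWeakCouplingLimit → PolyVolume sch → PolyRenorm r sch → UniformFunctionalBoundPlanes r sch →
        (∃ Δ C : ℝ, 0 < Δ ∧ RPSpectral r sch Δ C) → PlaneLimits r sch φ T →
        OddTorusSwapPairingLiminf r (subseq sch φ hφ)) ↔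
    (∀ (G : Type) [Group G] [TopologicalSpace G] [IsTopologicalGroup G] [CompactSpace G]
      [MeasurableSpace G] [BorelSpace G] (r : LatticeRep G) (sch : SpeciesScheme (YMSpecies G)),
      sch.HasWeakCouplingLimit → PolyVolume sch → PolyRenorm r sch → UniformFunctionalBoundPlanes r sch →
        (∃ Δ C : ℝ, 0 < Δ ∧ RPSpectral r sch Δ C) → OddTorusSwapPairingLiminf r sch) := by
  constructor
  · intro h G _ _ _ _ _ _ r sch hw hpv hpr hufb hgap
    obtain ⟨Δ, C, hΔ, hrp⟩ := hgap
    refine oddTorusSwapPairingLiminf_of_subsubseq r sch fun ψ hψ => ?_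
    obtain ⟨φ, hφ, T, hpl⟩ :=
      stub_planeLimits G r (subseq sch ψ hψ) (uniformFunctionalBoundPlanes_subseq r sch ψ hψ hufb)
    exact ⟨φ, hφ, h G r (subseq sch ψ hψ) φ hφ T (hasWeakCouplingLimit_subseq sch ψ hψ hw)
      (polyVolume_subseq sch ψ hψ hpv) (polyRenorm_subseq r sch ψ hψ hpr)
      (uniformFunctionalBoundPlanes_subseq r sch ψ hψ hufb) ⟨Δ, C, hΔ, rpSpectral_subseq r sch ψ hψ hrp⟩ hpl⟩
  · intro h G _ _ _ _ _ _ r sch φ hφ T hw hpv hpr hufb hgap _hpl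
    obtain ⟨Δ, C, hΔ, hrp⟩ := hgap
    exact h G r (subseq sch φ hφ) (hasWeakCouplingLimit_subseq sch φ hφ hw) (polyVolume_subseq sch φ hφ hpv)
      (polyRenorm_subseq r sch φ hφ hpr) (uniformFunctionalBoundPlanes_subseq r sch φ hφ hufb)
      ⟨Δ, C, hΔ, rpSpectral_subseq r sch φ hφ hrp⟩

end Decoration

/-! ## §3 The junk gauge group: at `Subsingleton G` the swap pairing is a perfect square -/

section JunkGroupSwap

variable {G : Type} [Group G] [TopologicalSpace G] [IsTopologicalGroup G] [CompactSpace G]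
  [MeasurableSpace G] [BorelSpace G]

/-- For a one-element gauge group the curvature `n`-point function is the deterministic product of the one-point smearings at any
configuration `V₀`. -/
theorem latticeSchwinger_of_subsingleton [Subsingleton G] (r : LatticeRep G) (sch : SpeciesScheme (YMSpecies G)) (k n : ℕ)
    (u : Fin n → 𝓢(E4, ℝ)) (V₀ : LGConfig 4 G) :
    latticeSchwinger r.ρ sch (fun s => s.F) k n (fun _ => r.curvature) u =
      ∏ i, smearedLatticeField r.curvature.F (box 4 (sch.L k)) (sch.a k) (sch.c r.curvature k) (sch.m r.curvature k)
        (u i) V₀ := by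
  haveI := isProbabilityMeasure_wilsonMeasure (d := 4) (L := sch.side k) r.ρ r.continuous (sch.β k)
  unfold latticeSchwinger
  have hc : (fun U : GaugeConfig 4 (sch.side k) G => ∏ i, smearedLatticeField ((fun s : YMSpecies G => s.F)
      ((fun _ : Fin n => r.curvature) i)) (box 4 (sch.L k)) (sch.a k) (sch.c ((fun _ : Fin n => r.curvature) i) k)
      (sch.m ((fun _ : Fin n => r.curvature) i) k) (u i) (torusLift (sch.side k) U)) =
      fun _ => ∏ i, smearedLatticeField r.curvature.F (box 4 (sch.L k)) (sch.a k) (sch.c r.curvature k)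
        (sch.m r.curvature k) (u i) V₀ := by
    funext U
    exact Finset.prod_congr rfl fun i _ => by rw [Subsingleton.elim (torusLift (sch.side k) U) V₀]
  rw [hc, integral_const, smul_eq_mul, probReal_univ, one_mul]

/-- At a one-element gauge group the `n`-point function of an appended string factorises. -/
theorem latticeSchwinger_append_of_subsingleton [Subsingleton G] (r : LatticeRep G) (sch : SpeciesScheme (YMSpecies G))
    (k : ℕ) {n n' : ℕ} (u : Fin n → 𝓢(E4, ℝ)) (u' : Fin n' → 𝓢(E4, ℝ)) :
    latticeSchwinger r.ρ sch (fun s => s.F) k (n + n') (fun _ => r.curvature) (Fin.append u u') =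
      latticeSchwinger r.ρ sch (fun s => s.F) k n (fun _ => r.curvature) u *
        latticeSchwinger r.ρ sch (fun s => s.F) k n' (fun _ => r.curvature) u' := by
  simp only [latticeSchwinger_of_subsingleton r sch k _ _ (1 : LGConfig 4 G)]
  rw [Fin.prod_univ_add]
  simp only [Fin.append_left, Fin.append_right]

/-- **Mirror invariance (any gauge group).** The swap-mirrored string `σu j = u (rev j) ∘ swap₀₁` has the same curvature `n`-point
function: swap covariance of Wilson's torus measure (`latticeSchwinger_swap`, p827142) and re-indexing by `Fin.revPerm`. -/
theorem latticeSchwinger_mirror (r : LatticeRep G) (sch : SpeciesScheme (YMSpecies G)) (k : ℕ) {n : ℕ}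
    (u σu : Fin n → 𝓢(E4, ℝ)) (hσ : ∀ j x, σu j x = u (Fin.rev j) (swap01 x)) :
    latticeSchwinger r.ρ sch (fun s => s.F) k n (fun _ => r.curvature) σu =
      latticeSchwinger r.ρ sch (fun s => s.F) k n (fun _ => r.curvature) u := by
  rw [latticeSchwinger_swap r sch k n (u ∘ Fin.rev) σu fun p x => hσ p x]
  exact latticeSchwinger_comp_equiv r sch k Fin.revPerm u

/-- **The own-torus swap pairing at a one-element gauge group is a perfect square at every step**:
`Σᵢ Σᵢ' cᵢ cᵢ' ⟨∏Φ(σfᵢ) ∏Φ(fᵢ')⟩_k = (Σᵢ cᵢ ⟨∏ⱼ Φ(fᵢⱼ)⟩_k)²`. -/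
theorem swapPairing_eq_sq_of_subsingleton [Subsingleton G] (r : LatticeRep G) (sch : SpeciesScheme (YMSpecies G)) (k : ℕ)
    {m : ℕ} (n : Fin m → ℕ) (c : Fin m → ℝ) (f σf : (i : Fin m) → Fin (n i) → 𝓢(E4, ℝ))
    (hσ : ∀ i j (x : E4), σf i j x = f i (Fin.rev j) (swap01 x)) :
    ∑ i, ∑ i', c i * c i' *
        latticeSchwinger r.ρ sch (fun s => s.F) k (n i + n i') (fun _ => r.curvature) (Fin.append (σf i) (f i')) =
      (∑ i, c i * latticeSchwinger r.ρ sch (fun s => s.F) k (n i) (fun _ => r.curvature) (f i)) ^ 2 := by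
  rw [sq, Finset.sum_mul_sum]
  refine Finset.sum_congr rfl fun i _ => Finset.sum_congr rfl fun i' _ => ?_
  rw [latticeSchwinger_append_of_subsingleton, latticeSchwinger_mirror r sch k (f i) (σf i) (hσ i)]
  ring

/-- **Junk-group door closed for D1′.** For every one-element gauge group, every `LatticeRep` and every scheme,
`OddTorusSwapPairingLiminf r sch` holds (no hypothesis of D1′ is needed). -/
theorem oddTorusSwapPairingLiminf_of_subsingleton [Subsingleton G] (r : LatticeRep G) (sch : SpeciesScheme (YMSpecies G)) :
    OddTorusSwapPairingLiminf r sch := by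
  intro m n c f σf _hf _hdisj hσ
  refine liminf_nonneg_of_eventually (Filter.Eventually.of_forall fun k => ?_)
  rw [swapPairing_eq_sq_of_subsingleton r sch k n c f σf hσ]
  exact sq_nonneg _

/-- … hence D1′'s conclusion holds at every one-element gauge group along every subsequence. -/
theorem oddTorusSwapPairingLiminf_subseq_of_subsingleton [Subsingleton G] (r : LatticeRep G)
    (sch : SpeciesScheme (YMSpecies G)) (φ : ℕ → ℕ) (hφ : StrictMono φ) :
    OddTorusSwapPairingLiminf r (subseq sch φ hφ) :=
  oddTorusSwapPairingLiminf_of_subsingleton r (subseq sch φ hφ)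

end JunkGroupSwap

end Summit.QuantumFields.YangMills.Theorems.WeakCouplingHypercubicLimitRP.Negative.OddTorusSwapPairingLiminf

end
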